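import Summits.BirchSwinnertonDyer.Rank1Residual.Additive.X3ThreeLineDatum
import Summits.BirchSwinnertonDyer.Rank1Residual.X2.CellAGVParCertificatesN9A
import Mathlib.Tactic.Simproc.Factors
import HarnessLib

/-!
# X3♯(G-ord, `e = 2`) at `p = 3`: kernel records of the per-pair LINE DATUM `X3LineDatumThree W` for the
# Case-1 members of the B-X3G booking list — part H of 16 (cell `bsd-addord`, seat
# `bsd-addord-twist`, strategy = twist transport)

HONEST FRAMING (cell `bsd-addord`, `run/shared/lean/pub/bsd-addord/README.md` §4): the programme's
target of record is the full Birch–Swinnerton-Dyer formula for every `E/ℚ` of analytic rank `≤ 1`.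
DATA-RECORDS module: theorems only (no definition, no named fact, no `sorry`); it BOOKS NOTHING and
moves no mark — booking is the planner's act (TARGET.md v5.5 §8 protocol B-X3G, (iv)).

## What is recorded

For each isogeny class `(N, class, 3)` of the booking list `HOME/bsd-addord-twist-booking-members.tsv`
(kit job j242057; the r_an = 0, non-CM, non-degenerate branch-parity classes of cell (G-ord, `e = 2`) at
`p = 3` in census v2, planner keys `HOME/planner/bx3g/`), the CASE-1 MEMBER `W = [a₁, a₂, a₃, a₄, a₆]`
(Cremona's globally minimal model; the first member in Cremona order carrying the EVEN rational `3`-line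
as a SUB-line) and the theorem `X3LineDatumThree W` — SOME rational `3`-line `Φ₀ ≤ W[3]` which is even,
has non-trivial `Γ_ℚ`-action and `χ_{−3}`-twist ramified at `3` — proved by
`x3LineDatumThree_of_cert_of_delta` from the certificate `(x₀, s, D, q)`: `Ψ₃(x₀) = 0`, `D` squarefree,
`s ≠ 0`, `D·s² = Ψ₂Sq(x₀)`, `0 < D`, `D ≠ 1`, `3 ∤ D` (`norm_num` identities, one prime-factor-list
computation with X2a's helper `squarefree_of_nodup_primeFactorsList_natAbs`, `decide`s). This is the per-pair line-datum input of
`ClassX3Gord.{{missingLowerBoundAt,bsdp}}_three_rankZero_of_facts_of_nonAnomalous`; the class binders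
(`ClassX3Gord W 3`, `¬ HasCM`, `analyticRank = 0`, `ReductionNonAnomalous W 3`) are data of record
(Cremona / the planner's two-engine census), NOT kernel statements here; the other members of each class
are reached by Cassels (`N10.bsdp_of_isIsogenous_of_bsdp`, binder `bsdRHS_eq_of_isIsogenous`). The
docstring of each record names the class, the anomalous bit of the twist `V = W ⊗ χ_{−3}` and `D`
(`φ = χ_D`). Records sorted by conductor.

References: [GreenbergVatsal2000] §2 p. 28 (the line `Φ`); lane file
`HOME/bsd-addord-twist-booking-members.tsv`; `Additive/X3ThreeLineDatum.lean`.
-/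

set_option autoImplicit false

open WeierstrassCurve Polynomial Literature.NumberTheory.EllipticCurves
  Literature.NumberTheory.EllipticCurves.Rank1Residual

namespace Summit.BirchSwinnertonDyer.Rank1Residual.Additive.X3ThreeLineDatumRecords

/-- `182700br2` = `[0,0,0,-12540,540605]` (class `182700br`, (G-ord, `e = 2`) at `3`; twist `20300b2`, `a₃(V) = -1`, non-anomalous; even line
`φ = χ_{5}`): `x₀ = 60`, `D = 5`, `s = 58`, `Ψ₂Sq(x₀) = 16820` ⇒ `X3LineDatumThree W`. [folklore] -/
theorem x3LineDatumThree_182700br2 : X3LineDatumThree (⟨0, 0, 0, -12540, 540605⟩ : WeierstrassCurve ℚ) :=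
  x3LineDatumThree_of_cert_of_delta _ (by norm_num [Δ, b₂, b₄, b₆, b₈]) 60 58 5
    (by simp only [Ψ₃, eval_add, eval_mul, eval_pow, eval_C, eval_X, eval_ofNat]; norm_num [b₂, b₄, b₆, b₈])
    (X2.CellACertN9.squarefree_of_nodup_primeFactorsList_natAbs (by norm_num) (by simp [Nat.primeFactorsList_ofNat])) (by norm_num)
    (by rw [KernelDisc.eval_Ψ₂Sq]; norm_num [b₂, b₄, b₆]) (by decide) (by decide) (by decide)

/-- `182700bu3` = `[0,0,0,-1894800,999975125]` (class `182700bu`, (G-ord, `e = 2`) at `3`; twist `20300d3`, `a₃(V) = 2`, non-anomalous; even line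
`φ = χ_{5}`): `x₀ = 960`, `D = 5`, `s = 7250`, `Ψ₂Sq(x₀) = 262812500` ⇒ `X3LineDatumThree W`. [folklore] -/
theorem x3LineDatumThree_182700bu3 : X3LineDatumThree (⟨0, 0, 0, -1894800, 999975125⟩ : WeierstrassCurve ℚ) :=
  x3LineDatumThree_of_cert_of_delta _ (by norm_num [Δ, b₂, b₄, b₆, b₈]) 960 7250 5
    (by simp only [Ψ₃, eval_add, eval_mul, eval_pow, eval_C, eval_X, eval_ofNat]; norm_num [b₂, b₄, b₆, b₈])
    (X2.CellACertN9.squarefree_of_nodup_primeFactorsList_natAbs (by norm_num) (by simp [Nat.primeFactorsList_ofNat])) (by norm_num)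
    (by rw [KernelDisc.eval_Ψ₂Sq]; norm_num [b₂, b₄, b₆]) (by decide) (by decide) (by decide)

/-- `183150bf2` = `[1,-1,1,-407930,166934697]` (class `183150bf`, (G-ord, `e = 2`) at `3`; twist `20350c2`, `a₃(V) = -1`, non-anomalous; even line
`φ = χ_{5}`): `x₀ = 94`, `D = 5`, `s = 10175`, `Ψ₂Sq(x₀) = 517653125` ⇒ `X3LineDatumThree W`. [folklore] -/
theorem x3LineDatumThree_183150bf2 : X3LineDatumThree (⟨1, -1, 1, -407930, 166934697⟩ : WeierstrassCurve ℚ) :=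
  x3LineDatumThree_of_cert_of_delta _ (by norm_num [Δ, b₂, b₄, b₆, b₈]) 94 10175 5
    (by simp only [Ψ₃, eval_add, eval_mul, eval_pow, eval_C, eval_X, eval_ofNat]; norm_num [b₂, b₄, b₆, b₈])
    (X2.CellACertN9.squarefree_of_nodup_primeFactorsList_natAbs (by norm_num) (by simp [Nat.primeFactorsList_ofNat])) (by norm_num)
    (by rw [KernelDisc.eval_Ψ₂Sq]; norm_num [b₂, b₄, b₆]) (by decide) (by decide) (by decide)

/-- `183150dy2` = `[1,-1,0,-11142,2782516]` (class `183150dy`, (G-ord, `e = 2`) at `3`; twist `20350v2`, `a₃(V) = 2`, non-anomalous; even line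
`φ = χ_{5}`): `x₀ = 4`, `D = 5`, `s = 1480`, `Ψ₂Sq(x₀) = 10952000` ⇒ `X3LineDatumThree W`. [folklore] -/
theorem x3LineDatumThree_183150dy2 : X3LineDatumThree (⟨1, -1, 0, -11142, 2782516⟩ : WeierstrassCurve ℚ) :=
  x3LineDatumThree_of_cert_of_delta _ (by norm_num [Δ, b₂, b₄, b₆, b₈]) 4 1480 5
    (by simp only [Ψ₃, eval_add, eval_mul, eval_pow, eval_C, eval_X, eval_ofNat]; norm_num [b₂, b₄, b₆, b₈])
    (X2.CellACertN9.squarefree_of_nodup_primeFactorsList_natAbs (by norm_num) (by simp [Nat.primeFactorsList_ofNat])) (by norm_num)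
    (by rw [KernelDisc.eval_Ψ₂Sq]; norm_num [b₂, b₄, b₆]) (by decide) (by decide) (by decide)

/-- `183150ed2` = `[1,-1,0,-1205307,509626021]` (class `183150ed`, (G-ord, `e = 2`) at `3`; twist `20350u2`, `a₃(V) = -1`, non-anomalous; even line
`φ = χ_{5}`): `x₀ = 634`, `D = 5`, `s = 4`, `Ψ₂Sq(x₀) = 80` ⇒ `X3LineDatumThree W`. [folklore] -/
theorem x3LineDatumThree_183150ed2 : X3LineDatumThree (⟨1, -1, 0, -1205307, 509626021⟩ : WeierstrassCurve ℚ) :=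
  x3LineDatumThree_of_cert_of_delta _ (by norm_num [Δ, b₂, b₄, b₆, b₈]) 634 4 5
    (by simp only [Ψ₃, eval_add, eval_mul, eval_pow, eval_C, eval_X, eval_ofNat]; norm_num [b₂, b₄, b₆, b₈])
    (X2.CellACertN9.squarefree_of_nodup_primeFactorsList_natAbs (by norm_num) (by simp [Nat.primeFactorsList_ofNat])) (by norm_num)
    (by rw [KernelDisc.eval_Ψ₂Sq]; norm_num [b₂, b₄, b₆]) (by decide) (by decide) (by decide)

/-- `183618v2` = `[1,-1,0,2178,-186476]` (class `183618v`, (G-ord, `e = 2`) at `3`; twist `20402e2`, `a₃(V) = -1`, non-anomalous; even line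
`φ = χ_{101}`): `x₀ = 76`, `D = 101`, `s = 128`, `Ψ₂Sq(x₀) = 1654784` ⇒ `X3LineDatumThree W`. [folklore] -/
theorem x3LineDatumThree_183618v2 : X3LineDatumThree (⟨1, -1, 0, 2178, -186476⟩ : WeierstrassCurve ℚ) :=
  x3LineDatumThree_of_cert_of_delta _ (by norm_num [Δ, b₂, b₄, b₆, b₈]) 76 128 101
    (by simp only [Ψ₃, eval_add, eval_mul, eval_pow, eval_C, eval_X, eval_ofNat]; norm_num [b₂, b₄, b₆, b₈])
    (X2.CellACertN9.squarefree_of_nodup_primeFactorsList_natAbs (by norm_num) (by simp [Nat.primeFactorsList_ofNat])) (by norm_num)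
    (by rw [KernelDisc.eval_Ψ₂Sq]; norm_num [b₂, b₄, b₆]) (by decide) (by decide) (by decide)

/-- `185562c2` = `[1,-1,1,-5531909,4988207657]` (class `185562c`, (G-ord, `e = 2`) at `3`; twist `20618d2`, `a₃(V) = 1` — ANOMALOUS (outside the end state as typed); even line
`φ = χ_{13}`): `x₀ = 1648`, `D = 13`, `s = 10309`, `Ψ₂Sq(x₀) = 1381581253` ⇒ `X3LineDatumThree W`. [folklore] -/
theorem x3LineDatumThree_185562c2 : X3LineDatumThree (⟨1, -1, 1, -5531909, 4988207657⟩ : WeierstrassCurve ℚ) :=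
  x3LineDatumThree_of_cert_of_delta _ (by norm_num [Δ, b₂, b₄, b₆, b₈]) 1648 10309 13
    (by simp only [Ψ₃, eval_add, eval_mul, eval_pow, eval_C, eval_X, eval_ofNat]; norm_num [b₂, b₄, b₆, b₈])
    (X2.CellACertN9.squarefree_of_nodup_primeFactorsList_natAbs (by norm_num) (by simp [Nat.primeFactorsList_ofNat])) (by norm_num)
    (by rw [KernelDisc.eval_Ψ₂Sq]; norm_num [b₂, b₄, b₆]) (by decide) (by decide) (by decide)

/-- `185850bt2` = `[1,-1,1,-12761304665,561498789043257]` (class `185850bt`, (G-ord, `e = 2`) at `3`; twist `20650a2`, `a₃(V) = 2`, non-anomalous; even line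
`φ = χ_{5}`): `x₀ = 47884`, `D = 5`, `s = 6941291`, `Ψ₂Sq(x₀) = 240907603733405` ⇒ `X3LineDatumThree W`. [folklore] -/
theorem x3LineDatumThree_185850bt2 : X3LineDatumThree (⟨1, -1, 1, -12761304665, 561498789043257⟩ : WeierstrassCurve ℚ) :=
  x3LineDatumThree_of_cert_of_delta _ (by norm_num [Δ, b₂, b₄, b₆, b₈]) 47884 6941291 5
    (by simp only [Ψ₃, eval_add, eval_mul, eval_pow, eval_C, eval_X, eval_ofNat]; norm_num [b₂, b₄, b₆, b₈])
    (X2.CellACertN9.squarefree_of_nodup_primeFactorsList_natAbs (by norm_num) (by simp [Nat.primeFactorsList_ofNat])) (by norm_num)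
    (by rw [KernelDisc.eval_Ψ₂Sq]; norm_num [b₂, b₄, b₆]) (by decide) (by decide) (by decide)

/-- `185850ec2` = `[1,-1,0,-1496367,2060634541]` (class `185850ec`, (G-ord, `e = 2`) at `3`; twist `20650t2`, `a₃(V) = 2`, non-anomalous; even line
`φ = χ_{5}`): `x₀ = 94`, `D = 5`, `s = 39200`, `Ψ₂Sq(x₀) = 7683200000` ⇒ `X3LineDatumThree W`. [folklore] -/
theorem x3LineDatumThree_185850ec2 : X3LineDatumThree (⟨1, -1, 0, -1496367, 2060634541⟩ : WeierstrassCurve ℚ) :=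
  x3LineDatumThree_of_cert_of_delta _ (by norm_num [Δ, b₂, b₄, b₆, b₈]) 94 39200 5
    (by simp only [Ψ₃, eval_add, eval_mul, eval_pow, eval_C, eval_X, eval_ofNat]; norm_num [b₂, b₄, b₆, b₈])
    (X2.CellACertN9.squarefree_of_nodup_primeFactorsList_natAbs (by norm_num) (by simp [Nat.primeFactorsList_ofNat])) (by norm_num)
    (by rw [KernelDisc.eval_Ψ₂Sq]; norm_num [b₂, b₄, b₆]) (by decide) (by decide) (by decide)

/-- `186048dg3` = `[0,0,0,-2634060,1645027184]` (class `186048dg`, (G-ord, `e = 2`) at `3`; twist `20672n3`, `a₃(V) = 2`, non-anomalous; even line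
`φ = χ_{2}`): `x₀ = 1014`, `D = 2`, `s = 5776`, `Ψ₂Sq(x₀) = 66724352` ⇒ `X3LineDatumThree W`. [folklore] -/
theorem x3LineDatumThree_186048dg3 : X3LineDatumThree (⟨0, 0, 0, -2634060, 1645027184⟩ : WeierstrassCurve ℚ) :=
  x3LineDatumThree_of_cert_of_delta _ (by norm_num [Δ, b₂, b₄, b₆, b₈]) 1014 5776 2
    (by simp only [Ψ₃, eval_add, eval_mul, eval_pow, eval_C, eval_X, eval_ofNat]; norm_num [b₂, b₄, b₆, b₈])
    Int.prime_two.squarefree (by norm_num)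
    (by rw [KernelDisc.eval_Ψ₂Sq]; norm_num [b₂, b₄, b₆]) (by decide) (by decide) (by decide)

/-- `188550bu2` = `[1,-1,0,-7603542,8249360116]` (class `188550bu`, (G-ord, `e = 2`) at `3`; twist `20950h2`, `a₃(V) = -1`, non-anomalous; even line
`φ = χ_{5}`): `x₀ = 1084`, `D = 5`, `s = 32000`, `Ψ₂Sq(x₀) = 5120000000` ⇒ `X3LineDatumThree W`. [folklore] -/
theorem x3LineDatumThree_188550bu2 : X3LineDatumThree (⟨1, -1, 0, -7603542, 8249360116⟩ : WeierstrassCurve ℚ) :=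
  x3LineDatumThree_of_cert_of_delta _ (by norm_num [Δ, b₂, b₄, b₆, b₈]) 1084 32000 5
    (by simp only [Ψ₃, eval_add, eval_mul, eval_pow, eval_C, eval_X, eval_ofNat]; norm_num [b₂, b₄, b₆, b₈])
    (X2.CellACertN9.squarefree_of_nodup_primeFactorsList_natAbs (by norm_num) (by simp [Nat.primeFactorsList_ofNat])) (by norm_num)
    (by rw [KernelDisc.eval_Ψ₂Sq]; norm_num [b₂, b₄, b₆]) (by decide) (by decide) (by decide)

/-- `189450k2` = `[1,-1,1,8711500,-19575742953]` (class `189450k`, (G-ord, `e = 2`) at `3`; twist `21050f2`, `a₃(V) = -1`, non-anomalous; even line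
`φ = χ_{5}`): `x₀ = 3154`, `D = 5`, `s = 177241`, `Ψ₂Sq(x₀) = 157071860405` ⇒ `X3LineDatumThree W`. [folklore] -/
theorem x3LineDatumThree_189450k2 : X3LineDatumThree (⟨1, -1, 1, 8711500, -19575742953⟩ : WeierstrassCurve ℚ) :=
  x3LineDatumThree_of_cert_of_delta _ (by norm_num [Δ, b₂, b₄, b₆, b₈]) 3154 177241 5
    (by simp only [Ψ₃, eval_add, eval_mul, eval_pow, eval_C, eval_X, eval_ofNat]; norm_num [b₂, b₄, b₆, b₈])
    (X2.CellACertN9.squarefree_of_nodup_primeFactorsList_natAbs (by norm_num) (by simp [Nat.primeFactorsList_ofNat])) (by norm_num)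
    (by rw [KernelDisc.eval_Ψ₂Sq]; norm_num [b₂, b₄, b₆]) (by decide) (by decide) (by decide)

/-- `189504fd2` = `[0,0,0,-18156,4632752]` (class `189504fd`, (G-ord, `e = 2`) at `3`; twist `21056k2`, `a₃(V) = -1`, non-anomalous; even line
`φ = χ_{2}`): `x₀ = 6`, `D = 2`, `s = 3008`, `Ψ₂Sq(x₀) = 18096128` ⇒ `X3LineDatumThree W`. [folklore] -/
theorem x3LineDatumThree_189504fd2 : X3LineDatumThree (⟨0, 0, 0, -18156, 4632752⟩ : WeierstrassCurve ℚ) :=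
  x3LineDatumThree_of_cert_of_delta _ (by norm_num [Δ, b₂, b₄, b₆, b₈]) 6 3008 2
    (by simp only [Ψ₃, eval_add, eval_mul, eval_pow, eval_C, eval_X, eval_ofNat]; norm_num [b₂, b₄, b₆, b₈])
    Int.prime_two.squarefree (by norm_num)
    (by rw [KernelDisc.eval_Ψ₂Sq]; norm_num [b₂, b₄, b₆]) (by decide) (by decide) (by decide)

/-- `192150ca2` = `[1,-1,1,-788301005,1240740643497]` (class `192150ca`, (G-ord, `e = 2`) at `3`; twist `21350c2`, `a₃(V) = -1`, non-anomalous; even line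
`φ = χ_{5}`): `x₀ = 39784`, `D = 5`, `s = 5126135`, `Ψ₂Sq(x₀) = 131386300191125` ⇒ `X3LineDatumThree W`. [folklore] -/
theorem x3LineDatumThree_192150ca2 : X3LineDatumThree (⟨1, -1, 1, -788301005, 1240740643497⟩ : WeierstrassCurve ℚ) :=
  x3LineDatumThree_of_cert_of_delta _ (by norm_num [Δ, b₂, b₄, b₆, b₈]) 39784 5126135 5
    (by simp only [Ψ₃, eval_add, eval_mul, eval_pow, eval_C, eval_X, eval_ofNat]; norm_num [b₂, b₄, b₆, b₈])
    (X2.CellACertN9.squarefree_of_nodup_primeFactorsList_natAbs (by norm_num) (by simp [Nat.primeFactorsList_ofNat])) (by norm_num)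
    (by rw [KernelDisc.eval_Ψ₂Sq]; norm_num [b₂, b₄, b₆]) (by decide) (by decide) (by decide)

/-- `192474bn2` = `[1,-1,0,-1431,22351]` (class `192474bn`, (G-ord, `e = 2`) at `3`; twist `21386e2`, `a₃(V) = -1`, non-anomalous; even line
`φ = χ_{17}`): `x₀ = 13`, `D = 17`, `s = 37`, `Ψ₂Sq(x₀) = 23273` ⇒ `X3LineDatumThree W`. [folklore] -/
theorem x3LineDatumThree_192474bn2 : X3LineDatumThree (⟨1, -1, 0, -1431, 22351⟩ : WeierstrassCurve ℚ) :=
  x3LineDatumThree_of_cert_of_delta _ (by norm_num [Δ, b₂, b₄, b₆, b₈]) 13 37 17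
    (by simp only [Ψ₃, eval_add, eval_mul, eval_pow, eval_C, eval_X, eval_ofNat]; norm_num [b₂, b₄, b₆, b₈])
    (X2.CellACertN9.squarefree_of_nodup_primeFactorsList_natAbs (by norm_num) (by simp [Nat.primeFactorsList_ofNat])) (by norm_num)
    (by rw [KernelDisc.eval_Ψ₂Sq]; norm_num [b₂, b₄, b₆]) (by decide) (by decide) (by decide)

/-- `193950q2` = `[1,-1,1,-16205,5869797]` (class `193950q`, (G-ord, `e = 2`) at `3`; twist `21550c2`, `a₃(V) = -1`, non-anomalous; even line
`φ = χ_{5}`): `x₀ = 4`, `D = 5`, `s = 2155`, `Ψ₂Sq(x₀) = 23220125` ⇒ `X3LineDatumThree W`. [folklore] -/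
theorem x3LineDatumThree_193950q2 : X3LineDatumThree (⟨1, -1, 1, -16205, 5869797⟩ : WeierstrassCurve ℚ) :=
  x3LineDatumThree_of_cert_of_delta _ (by norm_num [Δ, b₂, b₄, b₆, b₈]) 4 2155 5
    (by simp only [Ψ₃, eval_add, eval_mul, eval_pow, eval_C, eval_X, eval_ofNat]; norm_num [b₂, b₄, b₆, b₈])
    (X2.CellACertN9.squarefree_of_nodup_primeFactorsList_natAbs (by norm_num) (by simp [Nat.primeFactorsList_ofNat])) (by norm_num)
    (by rw [KernelDisc.eval_Ψ₂Sq]; norm_num [b₂, b₄, b₆]) (by decide) (by decide) (by decide)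

/-- `195300bn2` = `[0,0,0,565800,427596500]` (class `195300bn`, (G-ord, `e = 2`) at `3`; twist `21700b2`, `a₃(V) = -1`, non-anomalous; even line
`φ = χ_{5}`): `x₀ = 60`, `D = 5`, `s = 19220`, `Ψ₂Sq(x₀) = 1847042000` ⇒ `X3LineDatumThree W`. [folklore] -/
theorem x3LineDatumThree_195300bn2 : X3LineDatumThree (⟨0, 0, 0, 565800, 427596500⟩ : WeierstrassCurve ℚ) :=
  x3LineDatumThree_of_cert_of_delta _ (by norm_num [Δ, b₂, b₄, b₆, b₈]) 60 19220 5
    (by simp only [Ψ₃, eval_add, eval_mul, eval_pow, eval_C, eval_X, eval_ofNat]; norm_num [b₂, b₄, b₆, b₈])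
    (X2.CellACertN9.squarefree_of_nodup_primeFactorsList_natAbs (by norm_num) (by simp [Nat.primeFactorsList_ofNat])) (by norm_num)
    (by rw [KernelDisc.eval_Ψ₂Sq]; norm_num [b₂, b₄, b₆]) (by decide) (by decide) (by decide)

/-- `195975x2` = `[0,0,1,-541200,-990167594]` (class `195975x`, (G-ord, `e = 2`) at `3`; twist `21775a2`, `a₃(V) = 2`, non-anomalous; even line
`φ = χ_{5}`): `x₀ = 1815`, `D = 5`, `s = 56615`, `Ψ₂Sq(x₀) = 16026291125` ⇒ `X3LineDatumThree W`. [folklore] -/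
theorem x3LineDatumThree_195975x2 : X3LineDatumThree (⟨0, 0, 1, -541200, -990167594⟩ : WeierstrassCurve ℚ) :=
  x3LineDatumThree_of_cert_of_delta _ (by norm_num [Δ, b₂, b₄, b₆, b₈]) 1815 56615 5
    (by simp only [Ψ₃, eval_add, eval_mul, eval_pow, eval_C, eval_X, eval_ofNat]; norm_num [b₂, b₄, b₆, b₈])
    (X2.CellACertN9.squarefree_of_nodup_primeFactorsList_natAbs (by norm_num) (by simp [Nat.primeFactorsList_ofNat])) (by norm_num)
    (by rw [KernelDisc.eval_Ψ₂Sq]; norm_num [b₂, b₄, b₆]) (by decide) (by decide) (by decide)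

/-- `196650bb2` = `[1,-1,1,3235,225717]` (class `196650bb`, (G-ord, `e = 2`) at `3`; twist `21850d2`, `a₃(V) = -1`, non-anomalous; even line
`φ = χ_{5}`): `x₀ = 4`, `D = 5`, `s = 437`, `Ψ₂Sq(x₀) = 954845` ⇒ `X3LineDatumThree W`. [folklore] -/
theorem x3LineDatumThree_196650bb2 : X3LineDatumThree (⟨1, -1, 1, 3235, 225717⟩ : WeierstrassCurve ℚ) :=
  x3LineDatumThree_of_cert_of_delta _ (by norm_num [Δ, b₂, b₄, b₆, b₈]) 4 437 5
    (by simp only [Ψ₃, eval_add, eval_mul, eval_pow, eval_C, eval_X, eval_ofNat]; norm_num [b₂, b₄, b₆, b₈])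
    (X2.CellACertN9.squarefree_of_nodup_primeFactorsList_natAbs (by norm_num) (by simp [Nat.primeFactorsList_ofNat])) (by norm_num)
    (by rw [KernelDisc.eval_Ψ₂Sq]; norm_num [b₂, b₄, b₆]) (by decide) (by decide) (by decide)

/-- `197325c2` = `[0,0,1,-2909550,-1836056219]` (class `197325c`, (G-ord, `e = 2`) at `3`; twist `21925a2`, `a₃(V) = -1`, non-anomalous; even line
`φ = χ_{5}`): `x₀ = 2940`, `D = 5`, `s = 109625`, `Ψ₂Sq(x₀) = 60088203125` ⇒ `X3LineDatumThree W`. [folklore] -/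
theorem x3LineDatumThree_197325c2 : X3LineDatumThree (⟨0, 0, 1, -2909550, -1836056219⟩ : WeierstrassCurve ℚ) :=
  x3LineDatumThree_of_cert_of_delta _ (by norm_num [Δ, b₂, b₄, b₆, b₈]) 2940 109625 5
    (by simp only [Ψ₃, eval_add, eval_mul, eval_pow, eval_C, eval_X, eval_ofNat]; norm_num [b₂, b₄, b₆, b₈])
    (X2.CellACertN9.squarefree_of_nodup_primeFactorsList_natAbs (by norm_num) (by simp [Nat.primeFactorsList_ofNat])) (by norm_num)
    (by rw [KernelDisc.eval_Ψ₂Sq]; norm_num [b₂, b₄, b₆]) (by decide) (by decide) (by decide)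

/-- `197550m2` = `[1,-1,1,287770,-73506603]` (class `197550m`, (G-ord, `e = 2`) at `3`; twist `21950c2`, `a₃(V) = 2`, non-anomalous; even line
`φ = χ_{5}`): `x₀ = 454`, `D = 5`, `s = 10975`, `Ψ₂Sq(x₀) = 602253125` ⇒ `X3LineDatumThree W`. [folklore] -/
theorem x3LineDatumThree_197550m2 : X3LineDatumThree (⟨1, -1, 1, 287770, -73506603⟩ : WeierstrassCurve ℚ) :=
  x3LineDatumThree_of_cert_of_delta _ (by norm_num [Δ, b₂, b₄, b₆, b₈]) 454 10975 5
    (by simp only [Ψ₃, eval_add, eval_mul, eval_pow, eval_C, eval_X, eval_ofNat]; norm_num [b₂, b₄, b₆, b₈])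
    (X2.CellACertN9.squarefree_of_nodup_primeFactorsList_natAbs (by norm_num) (by simp [Nat.primeFactorsList_ofNat])) (by norm_num)
    (by rw [KernelDisc.eval_Ψ₂Sq]; norm_num [b₂, b₄, b₆]) (by decide) (by decide) (by decide)

/-- `200277r2` = `[0,0,1,-128316,-81800222]` (class `200277r`, (G-ord, `e = 2`) at `3`; twist `22253b2`, `a₃(V) = -1`, non-anomalous; even line
`φ = χ_{17}`): `x₀ = 816`, `D = 17`, `s = 9163`, `Ψ₂Sq(x₀) = 1427329673` ⇒ `X3LineDatumThree W`. [folklore] -/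
theorem x3LineDatumThree_200277r2 : X3LineDatumThree (⟨0, 0, 1, -128316, -81800222⟩ : WeierstrassCurve ℚ) :=
  x3LineDatumThree_of_cert_of_delta _ (by norm_num [Δ, b₂, b₄, b₆, b₈]) 816 9163 17
    (by simp only [Ψ₃, eval_add, eval_mul, eval_pow, eval_C, eval_X, eval_ofNat]; norm_num [b₂, b₄, b₆, b₈])
    (X2.CellACertN9.squarefree_of_nodup_primeFactorsList_natAbs (by norm_num) (by simp [Nat.primeFactorsList_ofNat])) (by norm_num)
    (by rw [KernelDisc.eval_Ψ₂Sq]; norm_num [b₂, b₄, b₆]) (by decide) (by decide) (by decide)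

/-- `202950er2` = `[1,-1,0,-11814417,15633226741]` (class `202950er`, (G-ord, `e = 2`) at `3`; twist `22550bc2`, `a₃(V) = 2`, non-anomalous; even line
`φ = χ_{5}`): `x₀ = 1984`, `D = 5`, `s = 50`, `Ψ₂Sq(x₀) = 12500` ⇒ `X3LineDatumThree W`. [folklore] -/
theorem x3LineDatumThree_202950er2 : X3LineDatumThree (⟨1, -1, 0, -11814417, 15633226741⟩ : WeierstrassCurve ℚ) :=
  x3LineDatumThree_of_cert_of_delta _ (by norm_num [Δ, b₂, b₄, b₆, b₈]) 1984 50 5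
    (by simp only [Ψ₃, eval_add, eval_mul, eval_pow, eval_C, eval_X, eval_ofNat]; norm_num [b₂, b₄, b₆, b₈])
    (X2.CellACertN9.squarefree_of_nodup_primeFactorsList_natAbs (by norm_num) (by simp [Nat.primeFactorsList_ofNat])) (by norm_num)
    (by rw [KernelDisc.eval_Ψ₂Sq]; norm_num [b₂, b₄, b₆]) (by decide) (by decide) (by decide)

/-- `204624f2` = `[0,0,0,920661,3353888986]` (class `204624f`, (G-ord, `e = 2`) at `3`; twist `22736bi2`, `a₃(V) = 1` — ANOMALOUS (outside the end state as typed); even line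
`φ = χ_{7}`): `x₀ = 21`, `D = 7`, `s = 43904`, `Ψ₂Sq(x₀) = 13492928512` ⇒ `X3LineDatumThree W`. [folklore] -/
theorem x3LineDatumThree_204624f2 : X3LineDatumThree (⟨0, 0, 0, 920661, 3353888986⟩ : WeierstrassCurve ℚ) :=
  x3LineDatumThree_of_cert_of_delta _ (by norm_num [Δ, b₂, b₄, b₆, b₈]) 21 43904 7
    (by simp only [Ψ₃, eval_add, eval_mul, eval_pow, eval_C, eval_X, eval_ofNat]; norm_num [b₂, b₄, b₆, b₈])
    (X2.CellACertN9.squarefree_of_nodup_primeFactorsList_natAbs (by norm_num) (by simp [Nat.primeFactorsList_ofNat])) (by norm_num)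
    (by rw [KernelDisc.eval_Ψ₂Sq]; norm_num [b₂, b₄, b₆]) (by decide) (by decide) (by decide)

/-- `204624i2` = `[0,0,0,-50766744,139224952636]` (class `204624i`, (G-ord, `e = 2`) at `3`; twist `22736bo2`, `a₃(V) = -2` — ANOMALOUS (outside the end state as typed); even line
`φ = χ_{7}`): `x₀ = 4116`, `D = 7`, `s = 196`, `Ψ₂Sq(x₀) = 268912` ⇒ `X3LineDatumThree W`. [folklore] -/
theorem x3LineDatumThree_204624i2 : X3LineDatumThree (⟨0, 0, 0, -50766744, 139224952636⟩ : WeierstrassCurve ℚ) :=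
  x3LineDatumThree_of_cert_of_delta _ (by norm_num [Δ, b₂, b₄, b₆, b₈]) 4116 196 7
    (by simp only [Ψ₃, eval_add, eval_mul, eval_pow, eval_C, eval_X, eval_ofNat]; norm_num [b₂, b₄, b₆, b₈])
    (X2.CellACertN9.squarefree_of_nodup_primeFactorsList_natAbs (by norm_num) (by simp [Nat.primeFactorsList_ofNat])) (by norm_num)
    (by rw [KernelDisc.eval_Ψ₂Sq]; norm_num [b₂, b₄, b₆]) (by decide) (by decide) (by decide)

/-- `207450m2` = `[1,-1,1,-81230,-37007103]` (class `207450m`, (G-ord, `e = 2`) at `3`; twist `23050f2`, `a₃(V) = 2`, non-anomalous; even line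
`φ = χ_{5}`): `x₀ = 634`, `D = 5`, `s = 11525`, `Ψ₂Sq(x₀) = 664128125` ⇒ `X3LineDatumThree W`. [folklore] -/
theorem x3LineDatumThree_207450m2 : X3LineDatumThree (⟨1, -1, 1, -81230, -37007103⟩ : WeierstrassCurve ℚ) :=
  x3LineDatumThree_of_cert_of_delta _ (by norm_num [Δ, b₂, b₄, b₆, b₈]) 634 11525 5
    (by simp only [Ψ₃, eval_add, eval_mul, eval_pow, eval_C, eval_X, eval_ofNat]; norm_num [b₂, b₄, b₆, b₈])
    (X2.CellACertN9.squarefree_of_nodup_primeFactorsList_natAbs (by norm_num) (by simp [Nat.primeFactorsList_ofNat])) (by norm_num)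
    (by rw [KernelDisc.eval_Ψ₂Sq]; norm_num [b₂, b₄, b₆]) (by decide) (by decide) (by decide)

/-- `207936bs2` = `[0,0,0,1971060,-8482442992]` (class `207936bs`, (G-ord, `e = 2`) at `3`; twist `23104bt2`, `a₃(V) = -1`, non-anomalous; even line
`φ = χ_{38}`): `x₀ = 2850`, `D = 38`, `s = 46208`, `Ψ₂Sq(x₀) = 81136812032` ⇒ `X3LineDatumThree W`. [folklore] -/
theorem x3LineDatumThree_207936bs2 : X3LineDatumThree (⟨0, 0, 0, 1971060, -8482442992⟩ : WeierstrassCurve ℚ) :=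
  x3LineDatumThree_of_cert_of_delta _ (by norm_num [Δ, b₂, b₄, b₆, b₈]) 2850 46208 38
    (by simp only [Ψ₃, eval_add, eval_mul, eval_pow, eval_C, eval_X, eval_ofNat]; norm_num [b₂, b₄, b₆, b₈])
    (X2.CellACertN9.squarefree_of_nodup_primeFactorsList_natAbs (by norm_num) (by simp [Nat.primeFactorsList_ofNat])) (by norm_num)
    (by rw [KernelDisc.eval_Ψ₂Sq]; norm_num [b₂, b₄, b₆]) (by decide) (by decide) (by decide)

/-- `207936bu2` = `[0,0,0,-53580,4782224]` (class `207936bu`, (G-ord, `e = 2`) at `3`; twist `23104bv2`, `a₃(V) = -1`, non-anomalous; even line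
`φ = χ_{38}`): `x₀ = 114`, `D = 38`, `s = 128`, `Ψ₂Sq(x₀) = 622592` ⇒ `X3LineDatumThree W`. [folklore] -/
theorem x3LineDatumThree_207936bu2 : X3LineDatumThree (⟨0, 0, 0, -53580, 4782224⟩ : WeierstrassCurve ℚ) :=
  x3LineDatumThree_of_cert_of_delta _ (by norm_num [Δ, b₂, b₄, b₆, b₈]) 114 128 38
    (by simp only [Ψ₃, eval_add, eval_mul, eval_pow, eval_C, eval_X, eval_ofNat]; norm_num [b₂, b₄, b₆, b₈])
    (X2.CellACertN9.squarefree_of_nodup_primeFactorsList_natAbs (by norm_num) (by simp [Nat.primeFactorsList_ofNat])) (by norm_num)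
    (by rw [KernelDisc.eval_Ψ₂Sq]; norm_num [b₂, b₄, b₆]) (by decide) (by decide) (by decide)

/-- `207936cy2` = `[0,0,0,-121296,17298398]` (class `207936cy`, (G-ord, `e = 2`) at `3`; twist `23104bz2`, `a₃(V) = 2`, non-anomalous; even line
`φ = χ_{38}`): `x₀ = 114`, `D = 38`, `s = 722`, `Ψ₂Sq(x₀) = 19808792` ⇒ `X3LineDatumThree W`. [folklore] -/
theorem x3LineDatumThree_207936cy2 : X3LineDatumThree (⟨0, 0, 0, -121296, 17298398⟩ : WeierstrassCurve ℚ) :=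
  x3LineDatumThree_of_cert_of_delta _ (by norm_num [Δ, b₂, b₄, b₆, b₈]) 114 722 38
    (by simp only [Ψ₃, eval_add, eval_mul, eval_pow, eval_C, eval_X, eval_ofNat]; norm_num [b₂, b₄, b₆, b₈])
    (X2.CellACertN9.squarefree_of_nodup_primeFactorsList_natAbs (by norm_num) (by simp [Nat.primeFactorsList_ofNat])) (by norm_num)
    (by rw [KernelDisc.eval_Ψ₂Sq]; norm_num [b₂, b₄, b₆]) (by decide) (by decide) (by decide)

/-- `207936fm2` = `[0,0,0,-19342380,32801274416]` (class `207936fm`, (G-ord, `e = 2`) at `3`; twist `23104c2`, `a₃(V) = -1`, non-anomalous; even line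
`φ = χ_{2}`): `x₀ = 2166`, `D = 2`, `s = 46208`, `Ψ₂Sq(x₀) = 4270358528` ⇒ `X3LineDatumThree W`. [folklore] -/
theorem x3LineDatumThree_207936fm2 : X3LineDatumThree (⟨0, 0, 0, -19342380, 32801274416⟩ : WeierstrassCurve ℚ) :=
  x3LineDatumThree_of_cert_of_delta _ (by norm_num [Δ, b₂, b₄, b₆, b₈]) 2166 46208 2
    (by simp only [Ψ₃, eval_add, eval_mul, eval_pow, eval_C, eval_X, eval_ofNat]; norm_num [b₂, b₄, b₆, b₈])
    Int.prime_two.squarefree (by norm_num)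
    (by rw [KernelDisc.eval_Ψ₂Sq]; norm_num [b₂, b₄, b₆]) (by decide) (by decide) (by decide)

/-- `208350bk2` = `[1,-1,0,-468792,4884687616]` (class `208350bk`, (G-ord, `e = 2`) at `3`; twist `23150d2`, `a₃(V) = -1`, non-anomalous; even line
`φ = χ_{5}`): `x₀ = 4`, `D = 5`, `s = 62500`, `Ψ₂Sq(x₀) = 19531250000` ⇒ `X3LineDatumThree W`. [folklore] -/
theorem x3LineDatumThree_208350bk2 : X3LineDatumThree (⟨1, -1, 0, -468792, 4884687616⟩ : WeierstrassCurve ℚ) :=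
  x3LineDatumThree_of_cert_of_delta _ (by norm_num [Δ, b₂, b₄, b₆, b₈]) 4 62500 5
    (by simp only [Ψ₃, eval_add, eval_mul, eval_pow, eval_C, eval_X, eval_ofNat]; norm_num [b₂, b₄, b₆, b₈])
    (X2.CellACertN9.squarefree_of_nodup_primeFactorsList_natAbs (by norm_num) (by simp [Nat.primeFactorsList_ofNat])) (by norm_num)
    (by rw [KernelDisc.eval_Ψ₂Sq]; norm_num [b₂, b₄, b₆]) (by decide) (by decide) (by decide)

/-- `210240dj2` = `[0,0,0,-210252,37084016]` (class `210240dj`, (G-ord, `e = 2`) at `3`; twist `23360f2`, `a₃(V) = -1`, non-anomalous; even line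
`φ = χ_{2}`): `x₀ = 294`, `D = 2`, `s = 1168`, `Ψ₂Sq(x₀) = 2728448` ⇒ `X3LineDatumThree W`. [folklore] -/
theorem x3LineDatumThree_210240dj2 : X3LineDatumThree (⟨0, 0, 0, -210252, 37084016⟩ : WeierstrassCurve ℚ) :=
  x3LineDatumThree_of_cert_of_delta _ (by norm_num [Δ, b₂, b₄, b₆, b₈]) 294 1168 2
    (by simp only [Ψ₃, eval_add, eval_mul, eval_pow, eval_C, eval_X, eval_ofNat]; norm_num [b₂, b₄, b₆, b₈])
    Int.prime_two.squarefree (by norm_num)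
    (by rw [KernelDisc.eval_Ψ₂Sq]; norm_num [b₂, b₄, b₆]) (by decide) (by decide) (by decide)

/-- `212850dc2` = `[1,-1,0,-58617,5610541]` (class `212850dc`, (G-ord, `e = 2`) at `3`; twist `23650n2`, `a₃(V) = -1`, non-anomalous; even line
`φ = χ_{5}`): `x₀ = 94`, `D = 5`, `s = 860`, `Ψ₂Sq(x₀) = 3698000` ⇒ `X3LineDatumThree W`. [folklore] -/
theorem x3LineDatumThree_212850dc2 : X3LineDatumThree (⟨1, -1, 0, -58617, 5610541⟩ : WeierstrassCurve ℚ) :=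
  x3LineDatumThree_of_cert_of_delta _ (by norm_num [Δ, b₂, b₄, b₆, b₈]) 94 860 5
    (by simp only [Ψ₃, eval_add, eval_mul, eval_pow, eval_C, eval_X, eval_ofNat]; norm_num [b₂, b₄, b₆, b₈])
    (X2.CellACertN9.squarefree_of_nodup_primeFactorsList_natAbs (by norm_num) (by simp [Nat.primeFactorsList_ofNat])) (by norm_num)
    (by rw [KernelDisc.eval_Ψ₂Sq]; norm_num [b₂, b₄, b₆]) (by decide) (by decide) (by decide)

/-- `212850u2` = `[1,-1,1,4014895,-1255319103]` (class `212850u`, (G-ord, `e = 2`) at `3`; twist `23650c2`, `a₃(V) = -1`, non-anomalous; even line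
`φ = χ_{5}`): `x₀ = 1084`, `D = 5`, `s = 59125`, `Ψ₂Sq(x₀) = 17478828125` ⇒ `X3LineDatumThree W`. [folklore] -/
theorem x3LineDatumThree_212850u2 : X3LineDatumThree (⟨1, -1, 1, 4014895, -1255319103⟩ : WeierstrassCurve ℚ) :=
  x3LineDatumThree_of_cert_of_delta _ (by norm_num [Δ, b₂, b₄, b₆, b₈]) 1084 59125 5
    (by simp only [Ψ₃, eval_add, eval_mul, eval_pow, eval_C, eval_X, eval_ofNat]; norm_num [b₂, b₄, b₆, b₈])
    (X2.CellACertN9.squarefree_of_nodup_primeFactorsList_natAbs (by norm_num) (by simp [Nat.primeFactorsList_ofNat])) (by norm_num)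
    (by rw [KernelDisc.eval_Ψ₂Sq]; norm_num [b₂, b₄, b₆]) (by decide) (by decide) (by decide)

/-- `212940q2` = `[0,0,0,34008,-2983916]` (class `212940q`, (G-ord, `e = 2`) at `3`; twist `23660c2`, `a₃(V) = 1` — ANOMALOUS (outside the end state as typed); even line
`φ = χ_{13}`): `x₀ = 156`, `D = 13`, `s = 1372`, `Ψ₂Sq(x₀) = 24470992` ⇒ `X3LineDatumThree W`. [folklore] -/
theorem x3LineDatumThree_212940q2 : X3LineDatumThree (⟨0, 0, 0, 34008, -2983916⟩ : WeierstrassCurve ℚ) :=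
  x3LineDatumThree_of_cert_of_delta _ (by norm_num [Δ, b₂, b₄, b₆, b₈]) 156 1372 13
    (by simp only [Ψ₃, eval_add, eval_mul, eval_pow, eval_C, eval_X, eval_ofNat]; norm_num [b₂, b₄, b₆, b₈])
    (X2.CellACertN9.squarefree_of_nodup_primeFactorsList_natAbs (by norm_num) (by simp [Nat.primeFactorsList_ofNat])) (by norm_num)
    (by rw [KernelDisc.eval_Ψ₂Sq]; norm_num [b₂, b₄, b₆]) (by decide) (by decide) (by decide)

/-- `212940r2` = `[0,0,0,-1224912,521805076]` (class `212940r`, (G-ord, `e = 2`) at `3`; twist `23660b2`, `a₃(V) = 1` — ANOMALOUS (outside the end state as typed); even line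
`φ = χ_{13}`): `x₀ = 624`, `D = 13`, `s = 364`, `Ψ₂Sq(x₀) = 1722448` ⇒ `X3LineDatumThree W`. [folklore] -/
theorem x3LineDatumThree_212940r2 : X3LineDatumThree (⟨0, 0, 0, -1224912, 521805076⟩ : WeierstrassCurve ℚ) :=
  x3LineDatumThree_of_cert_of_delta _ (by norm_num [Δ, b₂, b₄, b₆, b₈]) 624 364 13
    (by simp only [Ψ₃, eval_add, eval_mul, eval_pow, eval_C, eval_X, eval_ofNat]; norm_num [b₂, b₄, b₆, b₈])
    (X2.CellACertN9.squarefree_of_nodup_primeFactorsList_natAbs (by norm_num) (by simp [Nat.primeFactorsList_ofNat])) (by norm_num)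
    (by rw [KernelDisc.eval_Ψ₂Sq]; norm_num [b₂, b₄, b₆]) (by decide) (by decide) (by decide)

/-- `215982cd2` = `[1,-1,0,-2061747,795674205]` (class `215982cd`, (G-ord, `e = 2`) at `3`; twist `23998k2`, `a₃(V) = 1` — ANOMALOUS (outside the end state as typed); even line
`φ = χ_{13}`): `x₀ = 1648`, `D = 13`, `s = 23998`, `Ψ₂Sq(x₀) = 7486752052` ⇒ `X3LineDatumThree W`. [folklore] -/
theorem x3LineDatumThree_215982cd2 : X3LineDatumThree (⟨1, -1, 0, -2061747, 795674205⟩ : WeierstrassCurve ℚ) :=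
  x3LineDatumThree_of_cert_of_delta _ (by norm_num [Δ, b₂, b₄, b₆, b₈]) 1648 23998 13
    (by simp only [Ψ₃, eval_add, eval_mul, eval_pow, eval_C, eval_X, eval_ofNat]; norm_num [b₂, b₄, b₆, b₈])
    (X2.CellACertN9.squarefree_of_nodup_primeFactorsList_natAbs (by norm_num) (by simp [Nat.primeFactorsList_ofNat])) (by norm_num)
    (by rw [KernelDisc.eval_Ψ₂Sq]; norm_num [b₂, b₄, b₆]) (by decide) (by decide) (by decide)

/-- `217152ey2` = `[0,0,0,194964,-162073168]` (class `217152ey`, (G-ord, `e = 2`) at `3`; twist `24128f2`, `a₃(V) = -1`, non-anomalous; even line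
`φ = χ_{2}`): `x₀ = 726`, `D = 2`, `s = 26912`, `Ψ₂Sq(x₀) = 1448511488` ⇒ `X3LineDatumThree W`. [folklore] -/
theorem x3LineDatumThree_217152ey2 : X3LineDatumThree (⟨0, 0, 0, 194964, -162073168⟩ : WeierstrassCurve ℚ) :=
  x3LineDatumThree_of_cert_of_delta _ (by norm_num [Δ, b₂, b₄, b₆, b₈]) 726 26912 2
    (by simp only [Ψ₃, eval_add, eval_mul, eval_pow, eval_C, eval_X, eval_ofNat]; norm_num [b₂, b₄, b₆, b₈])
    Int.prime_two.squarefree (by norm_num)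
    (by rw [KernelDisc.eval_Ψ₂Sq]; norm_num [b₂, b₄, b₆]) (by decide) (by decide) (by decide)

/-- `220545p2` = `[0,0,1,-403572,86922657]` (class `220545p`, (G-ord, `e = 2`) at `3`; twist `24505a2`, `a₃(V) = 1` — ANOMALOUS (outside the end state as typed); even line
`φ = χ_{13}`): `x₀ = 624`, `D = 13`, `s = 4901`, `Ψ₂Sq(x₀) = 312257413` ⇒ `X3LineDatumThree W`. [folklore] -/
theorem x3LineDatumThree_220545p2 : X3LineDatumThree (⟨0, 0, 1, -403572, 86922657⟩ : WeierstrassCurve ℚ) :=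
  x3LineDatumThree_of_cert_of_delta _ (by norm_num [Δ, b₂, b₄, b₆, b₈]) 624 4901 13
    (by simp only [Ψ₃, eval_add, eval_mul, eval_pow, eval_C, eval_X, eval_ofNat]; norm_num [b₂, b₄, b₆, b₈])
    (X2.CellACertN9.squarefree_of_nodup_primeFactorsList_natAbs (by norm_num) (by simp [Nat.primeFactorsList_ofNat])) (by norm_num)
    (by rw [KernelDisc.eval_Ψ₂Sq]; norm_num [b₂, b₄, b₆]) (by decide) (by decide) (by decide)

/-- `220950ba2` = `[1,-1,1,-1218605,-680255103]` (class `220950ba`, (G-ord, `e = 2`) at `3`; twist `24550b2`, `a₃(V) = -1`, non-anomalous; even line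
`φ = χ_{5}`): `x₀ = 1984`, `D = 5`, `s = 61375`, `Ψ₂Sq(x₀) = 18834453125` ⇒ `X3LineDatumThree W`. [folklore] -/
theorem x3LineDatumThree_220950ba2 : X3LineDatumThree (⟨1, -1, 1, -1218605, -680255103⟩ : WeierstrassCurve ℚ) :=
  x3LineDatumThree_of_cert_of_delta _ (by norm_num [Δ, b₂, b₄, b₆, b₈]) 1984 61375 5
    (by simp only [Ψ₃, eval_add, eval_mul, eval_pow, eval_C, eval_X, eval_ofNat]; norm_num [b₂, b₄, b₆, b₈])
    (X2.CellACertN9.squarefree_of_nodup_primeFactorsList_natAbs (by norm_num) (by simp [Nat.primeFactorsList_ofNat])) (by norm_num)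
    (by rw [KernelDisc.eval_Ψ₂Sq]; norm_num [b₂, b₄, b₆]) (by decide) (by decide) (by decide)

/-- `221760il3` = `[0,0,0,-51852,37497584]` (class `221760il`, (G-ord, `e = 2`) at `3`; twist `24640o3`, `a₃(V) = 2`, non-anomalous; even line
`φ = χ_{2}`): `x₀ = 6`, `D = 2`, `s = 8624`, `Ψ₂Sq(x₀) = 148746752` ⇒ `X3LineDatumThree W`. [folklore] -/
theorem x3LineDatumThree_221760il3 : X3LineDatumThree (⟨0, 0, 0, -51852, 37497584⟩ : WeierstrassCurve ℚ) :=
  x3LineDatumThree_of_cert_of_delta _ (by norm_num [Δ, b₂, b₄, b₆, b₈]) 6 8624 2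
    (by simp only [Ψ₃, eval_add, eval_mul, eval_pow, eval_C, eval_X, eval_ofNat]; norm_num [b₂, b₄, b₆, b₈])
    Int.prime_two.squarefree (by norm_num)
    (by rw [KernelDisc.eval_Ψ₂Sq]; norm_num [b₂, b₄, b₆]) (by decide) (by decide) (by decide)

/-- `222300bp2` = `[0,0,0,20985,2288270]` (class `222300bp`, (G-ord, `e = 2`) at `3`; twist `24700c2`, `a₃(V) = 2`, non-anomalous; even line
`φ = χ_{5}`): `x₀ = 15`, `D = 5`, `s = 1444`, `Ψ₂Sq(x₀) = 10425680` ⇒ `X3LineDatumThree W`. [folklore] -/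
theorem x3LineDatumThree_222300bp2 : X3LineDatumThree (⟨0, 0, 0, 20985, 2288270⟩ : WeierstrassCurve ℚ) :=
  x3LineDatumThree_of_cert_of_delta _ (by norm_num [Δ, b₂, b₄, b₆, b₈]) 15 1444 5
    (by simp only [Ψ₃, eval_add, eval_mul, eval_pow, eval_C, eval_X, eval_ofNat]; norm_num [b₂, b₄, b₆, b₈])
    (X2.CellACertN9.squarefree_of_nodup_primeFactorsList_natAbs (by norm_num) (by simp [Nat.primeFactorsList_ofNat])) (by norm_num)
    (by rw [KernelDisc.eval_Ψ₂Sq]; norm_num [b₂, b₄, b₆]) (by decide) (by decide) (by decide)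

/-- `222300bq2` = `[0,0,0,-229800,42456125]` (class `222300bq`, (G-ord, `e = 2`) at `3`; twist `24700b2`, `a₃(V) = -1`, non-anomalous; even line
`φ = χ_{5}`): `x₀ = 240`, `D = 5`, `s = 950`, `Ψ₂Sq(x₀) = 4512500` ⇒ `X3LineDatumThree W`. [folklore] -/
theorem x3LineDatumThree_222300bq2 : X3LineDatumThree (⟨0, 0, 0, -229800, 42456125⟩ : WeierstrassCurve ℚ) :=
  x3LineDatumThree_of_cert_of_delta _ (by norm_num [Δ, b₂, b₄, b₆, b₈]) 240 950 5
    (by simp only [Ψ₃, eval_add, eval_mul, eval_pow, eval_C, eval_X, eval_ofNat]; norm_num [b₂, b₄, b₆, b₈])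
    (X2.CellACertN9.squarefree_of_nodup_primeFactorsList_natAbs (by norm_num) (by simp [Nat.primeFactorsList_ofNat])) (by norm_num)
    (by rw [KernelDisc.eval_Ψ₂Sq]; norm_num [b₂, b₄, b₆]) (by decide) (by decide) (by decide)

end Summit.BirchSwinnertonDyer.Rank1Residual.Additive.X3ThreeLineDatumRecords
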